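import Literature.NumberTheory.EllipticCurves.Rank1Residual.Typed.Basic
import HarnessLib

/-!
# The JOINT lower half of the `p`-part of BSD over a quadratic pair (Miller's currency for a pair)

HONEST FRAMING (cell `b2b-bsdres`, run/shared/lean/b2b/bsd-rank1-residual/): the cell deletes the
COMBINATION-SHAPED residual classes of the BSD formula in analytic rank `≤ 1` from PUBLISHED
theorems only; the CONSTRUCTION-SHAPED classes are TYPED (missing-input `Prop`s), NOT attempted.
This is not "finishing BSD". Definitions + bookkeeping theorems only (a predicate, nothing
asserted; no named fact).

`Typed/Basic.lean` types a missing input at the level of its OUTPUT at ONE pair `(E, p)`: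
`MissingLowerBoundAt W p` = "`#Ш(E)_an` is a rational `q` with `ord_p q ≤ ord_p #Ш(E)`" (Miller 2011
Def. 1.1, the last clause of `BSD(E,p)`, lower half). Every theorem "over an imaginary quadratic
field `K`" — Gross–Zagier, Kolyvagin, the anticyclotomic main conjectures at the trivial character —
pays out for the PAIR `(E, E^{(d_K)})` at once, because `L(E/K,s) = L(E,s)·L(E^{(d_K)},s)` and, for
odd `p`, `Ш(E/K)[p^∞] ≅ Ш(E)[p^∞] ⊕ Ш(E^{(d_K)})[p^∞]` (Jetchev–Skinner–Wan 2017 §7.4.1; in the tree: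
`card_primaryComponent_sha_baseChange_quadratic_of_odd_of_finite`). This file names that currency:

* `JointLowerBoundAt W Wd p` — `#Ш(W)_an = q`, `#Ш(Wd)_an = q_d` rational with
  `ord_p q + ord_p q_d ≤ ord_p #Ш(W) + ord_p #Ш(Wd)`;
* `missingLowerBoundAt_of_joint_of_upper` — joint lower + the UPPER half of the partner `Wd` give
  `MissingLowerBoundAt W p` (and symmetrically `…_partner_…`); `joint_of_lower_of_lower` — two lower
  halves give the joint one (so the joint statement is the WEAKER currency); `jointLowerBoundAt_comm`.

Written in seat r3's folder sketch (team n1011, route r3 "anticyclotomic / Heegner line at an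
additive prime", `SketchB.lean`), landed for the cell by seat p10; consumers:
`Summits/…/Additive/AnticycJointLower.lean`.

References: Miller, LMS J. Comput. Math. 14 (2011) §1, Def. 1.1 [Miller2011LMS]; Jetchev–Skinner–Wan,
Camb. J. Math. 5 (2017) §7.4.1 [JetchevSkinnerWan2017].
-/

noncomputable section

open scoped Classical

open WeierstrassCurve Literature.NumberTheory.EllipticCurves
  Literature.NumberTheory.EllipticCurves.Rank1Residual

namespace Literature.NumberTheory.EllipticCurves.Rank1Residual.Typed

/-- **JOINT lower half of the `p`-part of BSD over a pair `(W, Wd)`** (think `Wd` = a `ℚ`-model of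
the quadratic twist `W^{(d_K)}`), Miller's currency (Def. 1.1, last clause of `BSD(E,p)`, lower
half) for the two curves at once: `#Ш(W)_an = q` and `#Ш(Wd)_an = q_d` are rational with
`ord_p q + ord_p q_d ≤ ord_p #Ш(W) + ord_p #Ш(Wd)`. The currency in which every theorem over an
imaginary quadratic `K` pays out (`L(E/K,s) = L(E,s)L(E^{(d_K)},s)`; `Ш(E/K)[p^∞] ≅ Ш(E)[p^∞] ⊕
Ш(E^{(d_K)})[p^∞]` for odd `p`, Jetchev–Skinner–Wan 2017 §7.4.1). A predicate on `(W, Wd, p)`;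
nothing asserted. [cite: Miller2011LMS, Def. 1.1 (arXiv:1010.2431 p. 3)]
[cite: JetchevSkinnerWan2017, §7.4.1 (arXiv:1512.06894 p. 30)] -/
def JointLowerBoundAt (W Wd : WeierstrassCurve ℚ) (p : ℕ) : Prop :=
  ∃ q qd : ℚ, shaAn W = (q : ℂ) ∧ shaAn Wd = (qd : ℂ) ∧
    padicValRat p q + padicValRat p qd ≤
      (padicValNat p W.shaOrder : ℤ) + (padicValNat p Wd.shaOrder : ℤ)

/-- **Joint lower over the pair + the UPPER half of the partner `Wd` ⟹ the LOWER half of `W`**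
(bookkeeping on Miller's currency: the rational value of `#Ш(Wd)_an` is unique, subtract).
[cite: Miller2011LMS, Def. 1.1] -/
theorem missingLowerBoundAt_of_joint_of_upper {W Wd : WeierstrassCurve ℚ} {p : ℕ}
    (hJ : JointLowerBoundAt W Wd p) (hU : MissingUpperBoundAt Wd p) :
    MissingLowerBoundAt W p := by
  obtain ⟨q, qd, hq, hqd, hle⟩ := hJ
  obtain ⟨qd', hqd', hu⟩ := hU
  have hqq : qd' = qd := by
    have : ((qd' : ℂ)) = (qd : ℂ) := by rw [← hqd', hqd]
    exact_mod_cast this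
  subst hqq
  exact ⟨q, hq, by omega⟩

/-- Symmetric form: joint lower + the upper half of `W` ⟹ the lower half of the partner `Wd`.
Bookkeeping. [cite: Miller2011LMS, Def. 1.1] -/
theorem missingLowerBoundAt_partner_of_joint_of_upper {W Wd : WeierstrassCurve ℚ} {p : ℕ}
    (hJ : JointLowerBoundAt W Wd p) (hU : MissingUpperBoundAt W p) :
    MissingLowerBoundAt Wd p := by
  obtain ⟨q, qd, hq, hqd, hle⟩ := hJ
  obtain ⟨q', hq', hu⟩ := hU
  have hqq : q' = q := by
    have : ((q' : ℂ)) = (q : ℂ) := by rw [← hq', hq]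
    exact_mod_cast this
  subst hqq
  exact ⟨qd, hqd, by omega⟩

/-- Conversely two lower halves give the joint lower half (so the joint statement is WEAKER than
the pair of `MissingLowerBoundAt`s). Bookkeeping. [cite: Miller2011LMS, Def. 1.1] -/
theorem joint_of_lower_of_lower {W Wd : WeierstrassCurve ℚ} {p : ℕ}
    (h : MissingLowerBoundAt W p) (hd : MissingLowerBoundAt Wd p) : JointLowerBoundAt W Wd p := by
  obtain ⟨q, hq, hle⟩ := h
  obtain ⟨qd, hqd, hled⟩ := hd
  exact ⟨q, qd, hq, hqd, by omega⟩

/-- The joint lower half is symmetric in the pair. Bookkeeping. [cite: Miller2011LMS, Def. 1.1] -/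
theorem jointLowerBoundAt_comm {W Wd : WeierstrassCurve ℚ} {p : ℕ}
    (hJ : JointLowerBoundAt W Wd p) : JointLowerBoundAt Wd W p := by
  obtain ⟨q, qd, hq, hqd, hle⟩ := hJ
  exact ⟨qd, q, hqd, hq, by omega⟩

/-- With BOTH upper halves, the joint lower half is the pair of `MissingPPartAt`s. Bookkeeping.
[cite: Miller2011LMS, Def. 1.1] -/
theorem missingPPartAt_and_of_joint_of_upper_of_upper {W Wd : WeierstrassCurve ℚ} {p : ℕ}
    (hJ : JointLowerBoundAt W Wd p) (hU : MissingUpperBoundAt W p)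
    (hUd : MissingUpperBoundAt Wd p) : MissingPPartAt W p ∧ MissingPPartAt Wd p :=
  ⟨missingPPartAt_of_lower_of_upper W p (missingLowerBoundAt_of_joint_of_upper hJ hUd) hU,
    missingPPartAt_of_lower_of_upper Wd p (missingLowerBoundAt_partner_of_joint_of_upper hJ hU) hUd⟩

end Literature.NumberTheory.EllipticCurves.Rank1Residual.Typed

end
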